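import Literature.NumberTheory.EllipticCurves.BurungaleSkinnerTianWan2024.GreenbergMainStatementOPEN
import Literature.NumberTheory.EllipticCurves.CastellaGrossiSkinner2025.GreenbergPAdicLFunction
import HarnessLib

/-!
# Yan–Zhu 2026, Def. 3.11 — the Greenberg `p`-adic `L`-function value frame, COORDINATE-FREE in the generator pair

X. Yan, X. Zhu, *The Iwasawa main conjecture for non-CM elliptic curves at non-ordinary / Eisenstein primes …*,
arXiv:2412.20078v4, Def. 3.11 (TeX l.865–871) with Thm. 3.9 (l.839–849): `𝓛_p^Gr(f/K) := h_K · 𝓛_𝔭(K)' · 𝓛_p(f/K, Σ)`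
where `𝓛_𝔭(K)'` is "the image of `𝓛_𝔭(K)` under the map `Λ_K^ur → Λ_K^ur`, `γ ↦ γ^{1−τ}` for `γ ∈ Γ_K`" (`τ` = complex
conjugation).  The tree's `IsGreenbergLFunctionAnyRoot₂` (file `BurungaleSkinnerTianWan2024/GreenbergMainStatementOPEN`,
after `YanZhu2026/GreenbergMainTheorems` (T2)) renders the twist `γ ↦ γ^{1−τ}` in the COORDINATES of a
(cyclotomic, anticyclotomic)-adapted generator pair — `(γ⁺)^{1−τ} = 1`, `(γ⁻)^{1−τ} = (γ⁻)²`, i.e. the Katz series is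
read at the point `(0, r(γ₂)² − 1)`.  This file gives the PRINTED, coordinate-free reading: the push-forward of a
measure along `γ ↦ γ^{1−τ}` evaluated at a character `ξ` of `Γ_K` is the measure evaluated at `γ ↦ ξ(γ)/ξ(τγτ)`, i.e.
at the Hecke character `ξ/ξ^τ`; so the Katz factor is the value of `LK` at the avatar point `(r'(g₁) − 1, r'(g₂) − 1)`
of a `p`-adic avatar `r'` of `ξ/ξ^τ` (`HeckeCharacter.galConj (IsCMField.complexConj K) ξ` = `ξ^τ`, as in
`CastellaGrossiSkinner2025.IsKatzMeasureV₂`).  For a (cyclotomic, anticyclotomic)-adapted pair the two readings agree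
point for point (`r'(γ⁺) = 1`, `r'(γ⁻) = r(γ⁻)²`); the coordinate-free one is meaningful for EVERY adapted pair
`(κ₁, κ₂; g₁, g₂)` — in particular at `p = 2`, where for `K` imaginary quadratic with `2` split and `h_K` odd the
module `Γ_K ≅ ℤ₂[Gal(K/ℚ)]` is regular, the cyclotomic and anticyclotomic `ℤ₂`-extensions share their first layer,
and NO (cyclotomic, anticyclotomic) pair is adapted (`ZpExtension.IsTopGeneratorPair` fails), so the coordinate
rendering has no instance there.  Everything else is VERBATIM `IsGreenbergLFunctionAnyRoot₂` (reduction-type-free: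
every root `α` of `x² − a_p x + p`; `L(f/K, ξ, 1)` through an entire continuation of `rankinSelbergEulerProductHecke`).
A characterising PREDICATE on a pair of series `(LK, G)`; nothing is asserted, no existence is claimed, no fact is
named.  Typed for the cell bsd-2adic (route `TwoAdicConverse`, crux `OrdLambdaHalfAtTwo`, research residuals O1/O2 of
P10 v3) by the pen `bsd-2adic-plan` GEN 32; lands through a named worker.

References: [YanZhu2024MainConjNonCM] Def. 3.11, Thm. 3.9; [BurungaleSkinnerTianWan2024] §1.2.1 (𝓛_p^Gr(g/L) as a
bounded measure on Γ_L); [CastellaGrossiSkinner2025] Def. 2.4.3, Thm. 2.4.2 (the `ρ^τ` transport); [deShalit1987]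
II.4.16–4.17.
-/

set_option autoImplicit false

noncomputable section

open scoped Classical

open PowerSeries NumberField IsDedekindDomain Field CongruenceSubgroup
  Literature.NumberTheory.GaloisRepresentations Literature.NumberTheory.EllipticCurves
  Literature.NumberTheory.EllipticCurves.ModularForms

namespace Literature.NumberTheory.EllipticCurves.YanZhu2026

variable {p : ℕ} [Fact p.Prime] {K : Type} [Field K] [NumberField K] [IsCMField K] {N : ℕ}

/-- **Yan–Zhu Def. 3.11, coordinate-free: `G = 𝓛_p^Gr(f/K) = h_K · 𝓛_𝔭(K)(ξ/ξ^τ) · 𝓛_p^II(f/K)` as a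
characterising predicate on `(LK, G)`** — VERBATIM `IsGreenbergLFunctionAnyRoot₂ ι v v̄ κ₁ κ₂ g₁ g₂ f D h_K LK G` with
the Katz factor `y` read at the avatar point `(r'(g₁) − 1, r'(g₂) − 1)` of a `p`-adic avatar `r'` of `ξ / ξ^τ`
(`ξ^τ = HeckeCharacter.galConj (IsCMField.complexConj K) ξ`) instead of the (cyclotomic, anticyclotomic)-coordinate
point `(0, r(g₂)² − 1)`: for every Hecke character `ξ` of `K` with avatar `r` factoring through the pair, unramified
everywhere, of infinity type `(−(m+1), n+1)`, every root `α` of the Hecke polynomial of `f` at `p`, the CM newform `θ`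
of `ξ·N^{−(m+1)}`, every entire `L` agreeing with the Rankin–Selberg Euler product on `re s > m + n + 3`, and every
value `y` of `LK` at the avatar point of `ξ/ξ^τ`:
`G(r(g₁) − 1, r(g₂) − 1) = h_K · y · ι⁻¹(typeTwoInterpolationValueL p N v v̄ α ξ (−(n+1)) (m+1) ⟨θ,θ⟩ (L 1))`.
A predicate; nothing asserted; no existence claimed.
[cite: YanZhu2024MainConjNonCM, Def. 3.11 (arXiv:2412.20078v4 TeX l.865–871: 𝓛_𝔭(K)' = image of 𝓛_𝔭(K) under γ ↦ γ^{1−τ}) with Thm. 3.9 (l.839–849)]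
[cite: CastellaGrossiSkinner2025, Def. 2.4.3 and Thm. 2.4.2 (the transport by τ, final TeX l.962–992)]
[cite: BurungaleSkinnerTianWan2024, §1.2.1 (tex l.690–694) (shape only; nothing asserted)] -/
def IsGreenbergLFunctionFree₂ (ι : PadicAlgCl p ≃+* ℂ) (v vbar : HeightOneSpectrum (𝓞 K))
    (κ₁ κ₂ : ZpExtension K p) (g₁ g₂ : absoluteGaloisGroup K) (f : CuspForm (Gamma0 N) 2)
    (D : ℕ) [NeZero D] (hK : ℕ) (LK G : PowerSeries (PowerSeries (PadicComplexInt p))) : Prop :=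
  ∀ (ξ : HeckeCharacter K) (r r' : FramedGaloisRep K (PadicAlgCl p) 1) (m n : ℕ) (α : ℂ),
    IsPAdicAvatarOf ι ξ r → FactorsThroughPair κ₁ κ₂ r →
    IsPAdicAvatarOf ι (ξ / HeckeCharacter.galConj (IsCMField.complexConj K) ξ) r' →
    (∀ w : HeightOneSpectrum (𝓞 K), ξ.IsUnramifiedAt w) →
    ξ.HasInfinityType (fun _ ↦ -((m : ℤ) + 1)) (fun _ ↦ (n : ℤ) + 1) →
    α ^ 2 - cuspCoeff f p * α + p = 0 →
    ∀ θ : CuspForm (Gamma1 D) ((m + n + 3 : ℕ) : ℤ),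
      IsCMNewformOf (ξ / HeckeCharacter.normCharacter K ^ (m + 1)) θ →
    ∀ (L : ℂ → ℂ), Differentiable ℂ L →
      (∀ s : ℂ, (m : ℝ) + n + 3 < s.re → L s = rankinSelbergEulerProductHecke f ξ s) →
    ∀ y : ℂ_[p], IntSeries.HasValueAt₂ LK (avatarValueAt r' g₁ - 1) (avatarValueAt r' g₂ - 1) y →
      IntSeries.HasValueAt₂ G (avatarValueAt r g₁ - 1) (avatarValueAt r g₂ - 1)
        ((hK : ℂ_[p]) * y *
          ((ι.symm (typeTwoInterpolationValueL p N v vbar α ξ (-((n : ℤ) + 1)) ((m : ℤ) + 1)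
              (cmPeterssonNormSq θ) (L 1)) : PadicAlgCl p) : ℂ_[p]))

/-- Unfolding of the coordinate-free frame at one character of the range: the prescribed value of `G`.
[cite: YanZhu2024MainConjNonCM, Def. 3.11 with Thm. 3.9 (arXiv:2412.20078v4 TeX l.839–871)] -/
theorem IsGreenbergLFunctionFree₂.hasValueAt₂ {ι : PadicAlgCl p ≃+* ℂ} {v vbar : HeightOneSpectrum (𝓞 K)}
    {κ₁ κ₂ : ZpExtension K p} {g₁ g₂ : absoluteGaloisGroup K} {f : CuspForm (Gamma0 N) 2} {D : ℕ} [NeZero D]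
    {hK : ℕ} {LK G : PowerSeries (PowerSeries (PadicComplexInt p))}
    (h : IsGreenbergLFunctionFree₂ ι v vbar κ₁ κ₂ g₁ g₂ f D hK LK G)
    {ξ : HeckeCharacter K} {r r' : FramedGaloisRep K (PadicAlgCl p) 1} {m n : ℕ} {α : ℂ}
    (hr : IsPAdicAvatarOf ι ξ r) (hκ : FactorsThroughPair κ₁ κ₂ r)
    (hr' : IsPAdicAvatarOf ι (ξ / HeckeCharacter.galConj (IsCMField.complexConj K) ξ) r')
    (hunr : ∀ w : HeightOneSpectrum (𝓞 K), ξ.IsUnramifiedAt w)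
    (hinf : ξ.HasInfinityType (fun _ ↦ -((m : ℤ) + 1)) (fun _ ↦ (n : ℤ) + 1))
    (hα : α ^ 2 - cuspCoeff f p * α + p = 0) {θ : CuspForm (Gamma1 D) ((m + n + 3 : ℕ) : ℤ)}
    (hθ : IsCMNewformOf (ξ / HeckeCharacter.normCharacter K ^ (m + 1)) θ)
    {L : ℂ → ℂ} (hL : Differentiable ℂ L)
    (hL' : ∀ s : ℂ, (m : ℝ) + n + 3 < s.re → L s = rankinSelbergEulerProductHecke f ξ s)
    {y : ℂ_[p]} (hy : IntSeries.HasValueAt₂ LK (avatarValueAt r' g₁ - 1) (avatarValueAt r' g₂ - 1) y) :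
    IntSeries.HasValueAt₂ G (avatarValueAt r g₁ - 1) (avatarValueAt r g₂ - 1)
      ((hK : ℂ_[p]) * y *
        ((ι.symm (typeTwoInterpolationValueL p N v vbar α ξ (-((n : ℤ) + 1)) ((m : ℤ) + 1)
            (cmPeterssonNormSq θ) (L 1)) : PadicAlgCl p) : ℂ_[p])) :=
  h ξ r r' m n α hr hκ hr' hunr hinf hα θ hθ L hL hL' y hy

/-- **The value prescribed by the coordinate-free frame is the value prescribed by the coordinate frame whenever the two
Katz readings agree** — if `LK` takes the value `y` at the (cyc, anti)-coordinate point `(0, r(g₂)² − 1)` AND at the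
avatar point of `ξ/ξ^τ`, both frames demand the same value of `G` at `(r(g₁) − 1, r(g₂) − 1)`; stated as the common
unfolding (the equality of the two points for an adapted (cyclotomic, anticyclotomic) pair is NOT proved here).
[cite: YanZhu2024MainConjNonCM, Def. 3.11 (arXiv:2412.20078v4 TeX l.865–871)] -/
theorem IsGreenbergLFunctionFree₂.hasValueAt₂_of_anyRoot₂ {ι : PadicAlgCl p ≃+* ℂ}
    {v vbar : HeightOneSpectrum (𝓞 K)} {κ₁ κ₂ : ZpExtension K p} {g₁ g₂ : absoluteGaloisGroup K}
    {f : CuspForm (Gamma0 N) 2} {D : ℕ} [NeZero D] {hK : ℕ} {LK G G' : PowerSeries (PowerSeries (PadicComplexInt p))}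
    (h : IsGreenbergLFunctionFree₂ ι v vbar κ₁ κ₂ g₁ g₂ f D hK LK G)
    (h' : IsGreenbergLFunctionAnyRoot₂ ι v vbar κ₁ κ₂ g₁ g₂ f D hK LK G')
    {ξ : HeckeCharacter K} {r r' : FramedGaloisRep K (PadicAlgCl p) 1} {m n : ℕ} {α : ℂ}
    (hr : IsPAdicAvatarOf ι ξ r) (hκ : FactorsThroughPair κ₁ κ₂ r)
    (hr' : IsPAdicAvatarOf ι (ξ / HeckeCharacter.galConj (IsCMField.complexConj K) ξ) r')
    (hunr : ∀ w : HeightOneSpectrum (𝓞 K), ξ.IsUnramifiedAt w)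
    (hinf : ξ.HasInfinityType (fun _ ↦ -((m : ℤ) + 1)) (fun _ ↦ (n : ℤ) + 1))
    (hα : α ^ 2 - cuspCoeff f p * α + p = 0) {θ : CuspForm (Gamma1 D) ((m + n + 3 : ℕ) : ℤ)}
    (hθ : IsCMNewformOf (ξ / HeckeCharacter.normCharacter K ^ (m + 1)) θ)
    {L : ℂ → ℂ} (hL : Differentiable ℂ L)
    (hL' : ∀ s : ℂ, (m : ℝ) + n + 3 < s.re → L s = rankinSelbergEulerProductHecke f ξ s)
    {y : ℂ_[p]} (hy : IntSeries.HasValueAt₂ LK (avatarValueAt r' g₁ - 1) (avatarValueAt r' g₂ - 1) y)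
    (hy' : IntSeries.HasValueAt₂ LK 0 (avatarValueAt r g₂ ^ 2 - 1) y)
    {x x' : ℂ_[p]} (hx : IntSeries.HasValueAt₂ G (avatarValueAt r g₁ - 1) (avatarValueAt r g₂ - 1) x)
    (hx' : IntSeries.HasValueAt₂ G' (avatarValueAt r g₁ - 1) (avatarValueAt r g₂ - 1) x') : x = x' :=
  (hx.unique (h ξ r r' m n α hr hκ hr' hunr hinf hα θ hθ L hL hL' y hy)).trans
    (hx'.unique (h' ξ r m n α hr hκ hunr hinf hα θ hθ L hL hL' y hy')).symm

end Literature.NumberTheory.EllipticCurves.YanZhu2026
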